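import Summits.QuantumFields.BalabanUV.Beta.FP.GhostLoopCountingMixRate
import Literature.MathematicalPhysics.QuantumFieldTheory.Balaban1983to89.B5Hk165TranslZd

/-!
# `BalabanUV.Beta.FP.GhostInnerLegLetters` — road «FP» for binder row D1, row KER-γ (α2) sub-row **α2-c** «GHOST» (d): THE INNER-LEG LETTERS OF THE GHOST MIX PIECES
# AT THE ROAD's INSTANCE `I := kerH (N−1) a` (pv23's whole-lattice scalar minimiser `𝓘_gh = G′Q′*(Q′G′Q′*)⁻¹` on `ℤ⁴`, `B5Hk103ScalarZd.kerH`) — (Icov) BLOCK COVARIANCE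
# (= question Q-α2c-3 of the lineage, journal l.28693, ANSWERED BY THE TREE: `B5Hk165TranslZd.kerH_translate`), (I₀) the SUP letter, (I) the decay letter and (J′) the
# coarse-moment letter (`GhostLoopCountingMixRate.ghostColumn_engineLetters_of_le`), packaged in EXACTLY the binder shapes `hIcov`∕`hI` of `GhostMixPieces.ledger_gmix2Piece`,
# `GhostMixPieceQuartic.ledger_gmix4Piece`, `GhostMixPieceCubic.ledger_gmix3Piece`, `GhostMixPieceGamma.ledger_gmix1Piece` (p254977 ∕ p255173 ∕ p255178 ∕ p255190)

HONEST DEPENDENCY (page 1, mandatory): continuum YM on T⁴ ⇐ BetaPertH ∧ nine spine estimates (0/9 proved); BetaPertH ⇐ (D1) ∧ (D4) ∧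
CAP+tail; G-an2-4 gates asym, D1 and NE2/3/4.  HONEST FRAMING (cell contract, verbatim): «discharging `BetaPertH` makes Bałaban's UV
stability UNCONDITIONAL — a real constructive-QFT result; it is NOT the continuum limit and NOT the Clay problem.»  THIS MODULE is [folklore] bookkeeping over two TREE
certificates BY NAME (pv23's `kerH_translate`; the (I-gh) lineage's `ghostColumn_engineLetters_of_le`); it defines nothing, asserts nothing about Bałaban's constrained
objects beyond those certificates (the scalar `U = 1` minimiser on `ℤ⁴` IS a road object — the ghost words' inner leg, E-d1leaf05g15-1), cites nothing, mints no `Prop`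
fact, 0 sorry.  NOT the other displayed letters of the pieces ((radCov)(Ucov) of the averaging family, (Msup)∕(Psup), the junction's (Kcov)(col)(J)(J′) at `colH (KPerf m)` —
leaf-01's `PerfectColumnLettersColH` p255483 serves the latter), NOT (H2), NOT the (LEDGER)'s numbers, NOT hsplit, NOT D1; 0∕4 row-D1 binders; NOT BetaPertH, NOT continuum,
NOT Clay.

ABSOLUTE RULE (cell charter, verbatim): «No internally-minted statement may enter as a cited fact. Every hypothesis is either kernel-proved in this
package or a verbatim quotation of a PUBLISHED theorem with page reference. The manuscript(s) under audit are NOT citable for their own disputed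
steps — they are the thing under adjudication; programme-internal (2001/route/tribunal) claims are never citable.»

CONTENT ([folklore]; `Pt = ℤ⁴`, blocking `N ≥ 1`, tilt `a > 0`):
* §1 **`kerH_blockCov`** — (Icov) VERBATIM: `kerH (N−1) a (x + N•t) (u + t) = kerH (N−1) a x u` (`kerH_translate` with `bshift (N−1) t = N•t`).
* §2 **`ghostInnerLeg_letters`** — ONE `C, C′ ≥ 0` such that for every rate `δ ∈ (0, deltaH 4 1]`, every `a > 0`, every `N ≥ 1`: (I₀) `|kerH (N−1) a x u| ≤ C`,
  (I) `|kerH (N−1) a x u| ≤ C·e^{−(δ∕N)‖x − N•u‖∞}`, (J′) `Σ_{v∈V}(1 + (‖b′−N•v‖∞∕N)²)·|kerH (N−1) a b′ v| ≤ C′` (every finite coarse `V`), (Icov).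
Provenance: D1 formalisation swarm LEAF PROVER 05, unit `b2b-balaban-beta-d1-formalise-leaf-05` gen 16, 2026-08-21, road FP row KER-γ (α2) sub-row α2-c (d) (lineage menu of
the g15 CLOSING ADDENDUM, Q-α2c-3); «not in print; our bookkeeping»; no existing file touched.
-/

noncomputable section

namespace Summit.QuantumFields.BalabanUV.Beta.FP.GhostInnerLegLetters

open Finset Real
open scoped BigOperators
open Literature.MathematicalPhysics.QuantumFieldTheory.Balaban1983to89
open Literature.MathematicalPhysics.QuantumFieldTheory.Balaban1983to89.Beta
open DyadicShell (Pt supNorm)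
open B5Hk103ScalarZd (kerH deltaH deltaH_pos)
open B5Hk165TranslZd (bshift kerH_translate)
open Summit.QuantumFields.BalabanUV.Beta.FP.MixLoopPowerCounting (supNorm_cast_nonneg)
open Summit.QuantumFields.BalabanUV.Beta.FP.GhostLoopCountingMixRate (ghostColumn_engineLetters_of_le)

/-! ## §1 (Icov): the inner leg is block covariant -/

/-- [folklore] pv23's block shift at blocking `N = (N − 1) + 1`: `bshift (N−1) t = N•t` (`1 ≤ N`). -/
theorem bshift_pred_eq {N : ℕ} (hN : 1 ≤ N) (t : Pt) : bshift (N - 1) t = (N : ℤ) • t := by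
  unfold bshift
  rw [Nat.sub_add_cancel hN]

/-- **(Icov) FOR THE ROAD's GHOST INNER LEG** [folklore]: `kerH (N−1) a (x + N•t) (u + t) = kerH (N−1) a x u` for every `a > 0`, `N ≥ 1`, `x u t ∈ ℤ⁴` — the binder `hIcov` of
`GhostMixPieces.ledger_gmix2Piece` ∕ `GhostMixPiece{Quartic,Cubic,Gamma}.ledger_gmix{4,3,1}Piece` at `I := kerH (N−1) a`, i.e. question Q-α2c-3 of the lineage answered by
pv23's `B5Hk165TranslZd.kerH_translate` BY NAME. -/
theorem kerH_blockCov {a : ℝ} (ha : 0 < a) {N : ℕ} (hN : 1 ≤ N) (x u t : Pt) :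
    kerH (N - 1) a (x + (N : ℤ) • t) (u + t) = kerH (N - 1) a x u := by
  rw [← bshift_pred_eq hN t]
  exact kerH_translate (N - 1) ha x u t

/-! ## §2 The four inner-leg letters together, one pair of constants for every rate `δ ≤ deltaH 4 1` -/

/-- **THE INNER-LEG LETTERS (I₀)(I)(J′)(Icov) OF THE GHOST MIX PIECES AT `I := kerH (N−1) a`** [folklore]: ONE `C, C′ ≥ 0` (those of
`GhostLoopCountingMixRate.ghostColumn_engineLetters_of_le`) such that for every `δ ∈ (0, deltaH 4 1]`, `a > 0`, `N ≥ 1`: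
(I₀) `|kerH (N−1) a x u| ≤ C` (the SUP letter `hI` of the quartic∕cubic∕Gamma pieces), (I) `|kerH (N−1) a x u| ≤ C·e^{−(δ∕N)‖x − N•u‖∞}` (the decay letter `hI` of the
(MIX-2) piece), (J′) `Σ_{v∈V}(1 + (‖b′ − N•v‖∞∕N)²)·|kerH (N−1) a b′ v| ≤ C′` for every finite coarse `V`, and (Icov) `kerH (N−1) a (x + N•t) (u + t) = kerH (N−1) a x u`. -/
theorem ghostInnerLeg_letters :
    ∃ C C' : ℝ, 0 ≤ C ∧ 0 ≤ C' ∧ ∀ δ : ℝ, 0 < δ → δ ≤ deltaH 4 1 → ∀ {a : ℝ}, 0 < a → ∀ (N : ℕ), 1 ≤ N →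
      (∀ x u : Pt, |kerH (N - 1) a x u| ≤ C) ∧
      (∀ x u : Pt, |kerH (N - 1) a x u| ≤ C * Real.exp (-(δ / N) * (supNorm (x - (N : ℤ) • u) : ℝ))) ∧
      (∀ (b' : Pt) (V : Finset Pt),
        ∑ v ∈ V, (1 + ((supNorm (b' - (N : ℤ) • v) : ℝ) / N) ^ 2) * |kerH (N - 1) a b' v| ≤ C') ∧
      (∀ x u t : Pt, kerH (N - 1) a (x + (N : ℤ) • t) (u + t) = kerH (N - 1) a x u) := by
  obtain ⟨C, C', hC, hC', h⟩ := ghostColumn_engineLetters_of_le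
  refine ⟨C, C', hC, hC', fun δ hδ hδle {a} ha N hN => ?_⟩
  obtain ⟨hI, hJ'⟩ := h δ hδ hδle ha N hN
  refine ⟨fun x u => (hI x u).trans ?_, hI, hJ', fun x u t => kerH_blockCov ha hN x u t⟩
  have hexp : Real.exp (-(δ / N) * (supNorm (x - (N : ℤ) • u) : ℝ)) ≤ 1 := by
    rw [Real.exp_le_one_iff, neg_mul, neg_nonpos]
    exact mul_nonneg (div_nonneg hδ.le (Nat.cast_nonneg _)) (supNorm_cast_nonneg _)
  calc C * Real.exp (-(δ / N) * (supNorm (x - (N : ℤ) • u) : ℝ)) ≤ C * 1 := mul_le_mul_of_nonneg_left hexp hC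
    _ = C := mul_one C

end Summit.QuantumFields.BalabanUV.Beta.FP.GhostInnerLegLetters

end
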